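import Summits.ResolutionOfSingularities.ResolutionOfSingularities.Theorems.PurelyInseparableDim4PhiLineSupercritical
import HarnessLib

/-!
# (K-Φ1) for a SET of boundary letters: isolation bounds `α` in a frame `(y, u₁, u₂)` by the TOTAL weight of the
# boundary letters lying in `(y₁, y₂, u₁)` (cell `res-dim4-pi`, K2(p) lane, Φ-line; rung-1 p-generic material)

[OURS · counted 0 · cell `res-dim4-pi` · seat res-dim4-p-11 g5 (Φ-line lineage).]  Nothing here proves any TAIL(p, d, e),
K2(p), or resolution of singularities in dimension ≥ 4 / characteristic `p` — NOT proved.  AI kernel work, weaker than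
expert review.

The tree's (K-Φ1) (`PhiLine.not_mem_pow_of_isIsolated`, `not_mem_primePow_loc_of_isIsolated`, p-11 g3; (K-Φ1)-n
`mul_alphaS_le_of_isIsolated`, p706570) reads ONE boundary letter: an isolated `F = x^r·G` has `G ∉ P^n` for every prime
`P ⊊ 𝔪₀` containing `x_h`, as soon as `p ≤ r_h + n` — so a SUBCRITICAL letter (`r_h + d < p`, i.e. `n > d`) gives no
bound on `α` (holder's rung-0 exit table: the `(2,2,2)` loop at `(7,3)`, a weight-`3` letter at `d = 3` are «outside the
Φ-line's reach» for this reason).  The same one-line argument reads a SET `T` of boundary letters: if `x_i ∈ P` for all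
`i ∈ T` then `x^r ∈ P^{r(T)}`, `r(T) = Σ_{i ∈ T} r_i`, hence

* §1 **`not_unit_mul_mem_pow_of_isIsolated_letters`** / **`not_mem_primePow_loc_of_isIsolated_letters`** — `G ∉ P^n`
  (resp. `∉ 𝔮^n` in `𝒪 = K[x]_{𝔪₀}`) whenever `p ≤ r(T) + n`;
* §2 **`mul_alphaS_le_of_isIsolated_letters`** — in every r.s.p. `c = (y₁, y₂, u₁, u₂)` of `𝒪` such that the letters of
  `T` lie in `(y₁, y₂, u₁)` (geometrically: the line `V(y₁, y₂, u₁)` lies in `E_i` for every `i ∈ T`) and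
  `p ≤ r(T) + n`, `n ≤ d`: Newton points of `(G)` exist and `d·αs ≤ (n − 1)·d!`.
So a subcritical letter `u₁ = x_h` is Φ-admissible at the states where the boundary letters whose hyperplanes contain
the line `{y = 0} ∩ E_h` have total weight `≥ p − d` (then `n := p − r(T) ≤ d`); `T = {h}` is the tree's (K-Φ1)-n.
Whether this position occurs on the open rung-0 rows is a question for the census, not claimed here.

[cite: CossartJannsenSaito2020, Lemma 11.5, Lemma 13.4 (3)] [folklore]  bears_on: LADDER-RESOLUTION:D157-DOOR2 (res-dim4-pi ·
K2(p) rung 1 · Φ-line (K-Φ1) for letter sets).  Supports stmt-ResolutionOfSingularities-16155 (helper).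
-/

set_option linter.dupNamespace false -- mandated namespace of this single-conjunct summit

noncomputable section

namespace Summit.ResolutionOfSingularities.ResolutionOfSingularities.Theorems.PIDim4

namespace PhiLine

open MvPolynomial Finset IsLocalRing
open Literature.AlgebraicGeometry.Resolution
open Literature.AlgebraicGeometry.Resolution.WeightedOrder

variable {K : Type} [Field K]

/-! ## §1 The polynomial and local prime forms for a letter set -/

/-- `x^r ∈ P^{r(T)}` when `x_i ∈ P` for every `i ∈ T` (`r(T) = Σ_{i∈T} r_i`). [folklore] -/
theorem monomial_mem_pow_sum_of_forall_X_mem {P : Ideal (MvPolynomial (Fin 4) K)} (T : Finset (Fin 4))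
    (hT : ∀ i ∈ T, (X i : MvPolynomial (Fin 4) K) ∈ P) (r : Fin 4 →₀ ℕ) :
    monomial r (1 : K) ∈ P ^ (∑ i ∈ T, r i) := by
  classical
  have hmon : monomial r (1 : K) = ∏ i : Fin 4, (X i : MvPolynomial (Fin 4) K) ^ r i := by
    rw [monomial_eq, C_1, one_mul, Finsupp.prod_fintype _ _ (fun i => by rw [pow_zero])]
  rw [hmon, ← Finset.prod_mul_prod_compl T, ← Finset.prod_pow_eq_pow_sum]
  exact Ideal.mul_mem_right _ _ (Ideal.prod_mem_prod fun i hi => Ideal.pow_mem_pow (hT i hi) _)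

/-- **(K-Φ1) for a letter set, up to a unit.**  For an isolated `F = x^r·G`, a prime `P ⊊ 𝔪₀` containing the letters
`x_i`, `i ∈ T`, with `p ≤ r(T) + n`, and `t ∉ 𝔪₀`: `t·G ∉ P^n`. [cite: CossartJannsenSaito2020, Lemma 13.4 (3)] [folklore] -/
theorem not_unit_mul_mem_pow_of_isIsolated_letters {p n : ℕ} {F G t : MvPolynomial (Fin 4) K} {r : Fin 4 →₀ ℕ}
    (hF : F = monomial r 1 * G) (hiso : IsIsolated p F) {P : Ideal (MvPolynomial (Fin 4) K)} (hP : P.IsPrime)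
    (hPo : P ≤ originIdeal K) (hPne : P ≠ originIdeal K) (T : Finset (Fin 4))
    (hT : ∀ i ∈ T, (X i : MvPolynomial (Fin 4) K) ∈ P) (hn : p ≤ ∑ i ∈ T, r i + n) (ht : t ∉ originIdeal K) :
    t * G ∉ P ^ n := by
  intro hG
  have htF : t * F ∈ P ^ (∑ i ∈ T, r i + n) := by
    rw [hF, mul_left_comm, pow_add]
    exact Ideal.mul_mem_mul (monomial_mem_pow_sum_of_forall_X_mem T hT r) hG
  have hJ : singLocusIdeal p F ≤ P := singLocusIdeal_le_of_unit_mul_mem_pow hn hP (fun h' => ht (hPo h')) htF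
  haveI := hP
  obtain ⟨Q, hQ, hQP⟩ := Ideal.exists_minimalPrimes_le hJ
  have hQo : Q = originIdeal K := hiso.2 Q hQ (hQP.trans hPo)
  exact hPne (le_antisymm hPo (hQo ▸ hQP))

/-- **(K-Φ1) for a letter set, LOCAL PRIME FORM.**  In `𝒪 = OriginLocalization K 4`: for an isolated `F = x^r·G`, a letter
set `T` with `p ≤ r(T) + n` and every prime `𝔮 ≠ 𝔪` of `𝒪` containing the `x_i`, `i ∈ T`: `G ∉ 𝔮^n`.
[cite: CossartJannsenSaito2020, Lemma 13.4 (3)] [folklore] -/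
theorem not_mem_primePow_loc_of_isIsolated_letters {p n : ℕ} {F G : MvPolynomial (Fin 4) K} {r : Fin 4 →₀ ℕ}
    (hF : F = monomial r 1 * G) (hiso : IsIsolated p F) (T : Finset (Fin 4)) (hn : p ≤ ∑ i ∈ T, r i + n)
    {𝔮 : Ideal (OriginLocalization K 4)} (h𝔮 : 𝔮.IsPrime) (h𝔮ne : 𝔮 ≠ maximalIdeal (OriginLocalization K 4))
    (hT : ∀ i ∈ T, algebraMap (MvPolynomial (Fin 4) K) (OriginLocalization K 4) (X i) ∈ 𝔮) :
    algebraMap (MvPolynomial (Fin 4) K) (OriginLocalization K 4) G ∉ 𝔮 ^ n := by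
  intro hG
  haveI := h𝔮
  have hPprime : (𝔮.under (MvPolynomial (Fin 4) K)).IsPrime := Ideal.IsPrime.under _ _
  have hPo : 𝔮.under (MvPolynomial (Fin 4) K) ≤ originIdeal K := by
    have h1 : 𝔮.under (MvPolynomial (Fin 4) K) ≤ (maximalIdeal (OriginLocalization K 4)).under (MvPolynomial (Fin 4) K) :=
      Ideal.comap_mono (IsLocalRing.le_maximalIdeal h𝔮.ne_top)
    rw [Localization.AtPrime.under_maximalIdeal] at h1
    exact h1.trans originIdeal_loc_eq.le
  have hPne : 𝔮.under (MvPolynomial (Fin 4) K) ≠ originIdeal K := by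
    intro hPeq
    apply h𝔮ne
    rw [← IsLocalization.map_under (Literature.AlgebraicGeometry.Resolution.originIdeal K 4).primeCompl
      (OriginLocalization K 4) 𝔮, hPeq, ← originIdeal_loc_eq,
      IsLocalization.AtPrime.map_eq_maximalIdeal (Literature.AlgebraicGeometry.Resolution.originIdeal K 4)
        (OriginLocalization K 4)]
  have hXT : ∀ i ∈ T, (X i : MvPolynomial (Fin 4) K) ∈ 𝔮.under (MvPolynomial (Fin 4) K) :=
    fun i hi => Ideal.mem_comap.mpr (hT i hi)
  have hGd : algebraMap (MvPolynomial (Fin 4) K) (OriginLocalization K 4) G ∈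
      ((𝔮.under (MvPolynomial (Fin 4) K)) ^ n).map (algebraMap (MvPolynomial (Fin 4) K) (OriginLocalization K 4)) := by
    rw [Ideal.map_pow, IsLocalization.map_under (Literature.AlgebraicGeometry.Resolution.originIdeal K 4).primeCompl
      (OriginLocalization K 4) 𝔮]
    exact hG
  obtain ⟨t, ht, htG⟩ := exists_unit_mul_mem_of_algebraMap_mem_map hGd
  exact not_unit_mul_mem_pow_of_isIsolated_letters hF hiso hPprime hPo hPne T hXT hn ht htG

/-! ## §2 The polygon reading -/

/-- **(K-Φ1) for a letter set, POLYGON READING.**  In `𝒪_{𝔸⁴,0}`, for ANY regular system of parameters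
`c = (y₁, y₂, u₁, u₂)` such that the boundary letters `x_i`, `i ∈ T`, all lie in `(y₁, y₂, u₁)` (the line `V(y₁, y₂, u₁)`
lies in every `E_i`, `i ∈ T`), and an isolated state `F = x^r·G` with `p ≤ r(T) + n`, `n ≤ d`: Newton points of `(G)`
(degree `d`) exist and `d·αs ≤ (n − 1)·d!` — (K-Φ1) for `T` at `𝔮 = (y₁, y₂, u₁)` and (T2).  (`T = {h}`, `u₁ = x_h`:
the tree's `mul_alphaS_le_of_isIsolated`.) [cite: CossartJannsenSaito2020, Lemma 11.5, Lemma 13.4 (3)] [folklore] -/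
theorem mul_alphaS_le_of_isIsolated_letters {p d n : ℕ} {F G : MvPolynomial (Fin 4) K} {r : Fin 4 →₀ ℕ}
    (hF : F = monomial r 1 * G) (hiso : IsIsolated p F) (T : Finset (Fin 4)) (hn : p ≤ ∑ i ∈ T, r i + n) (hnd : n ≤ d)
    (c : Fin (2 + 2) → OriginLocalization K 4)
    (hgen : Ideal.span (Set.range c) = maximalIdeal (OriginLocalization K 4))
    (hT : ∀ i ∈ T, algebraMap (MvPolynomial (Fin 4) K) (OriginLocalization K 4) (X i) ∈ yu1Ideal c) :
    (pts c (Ideal.span {algebraMap (MvPolynomial (Fin 4) K) (OriginLocalization K 4) G}) d).Nonempty ∧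
      d * alphaS c (Ideal.span {algebraMap (MvPolynomial (Fin 4) K) (OriginLocalization K 4) G}) d ≤ (n - 1) * d.factorial := by
  have hdim : ringKrullDim (OriginLocalization K 4) = (2 : ℕ) + 2 := by
    rw [ringKrullDim_originLocalization]
    rfl
  refine mul_alphaS_le_of_not_le_yu1_pow c hgen hdim hnd fun hle => ?_
  exact not_mem_primePow_loc_of_isIsolated_letters hF hiso T hn (isPrime_yu1Ideal c hgen) (yu1Ideal_ne_maximalIdeal c hgen) hT
    (hle (Ideal.mem_span_singleton_self _))

/-- The frame condition of `mul_alphaS_le_of_isIsolated_letters` for the `u₁`-letter itself: `u₁ = x_h` gives `x_h ∈ (y₁, y₂, u₁)`.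
[folklore] -/
theorem algebraMap_X_mem_yu1Ideal_of_eq {c : Fin (2 + 2) → OriginLocalization K 4} {h : Fin 4}
    (hu1 : c (u1 2) = algebraMap (MvPolynomial (Fin 4) K) (OriginLocalization K 4) (X h)) :
    algebraMap (MvPolynomial (Fin 4) K) (OriginLocalization K 4) (X h) ∈ yu1Ideal c := by
  rw [← hu1]
  exact Ideal.subset_span (Set.mem_insert _ _)

/-- … and for a companion letter `x_i = Σ_k a_k·y_k + a·u₁` written on the frame's `(y, u₁)`-rows. [folklore] -/
theorem algebraMap_X_mem_yu1Ideal_of_eq_sum {c : Fin (2 + 2) → OriginLocalization K 4} {i : Fin 4} (a : Fin 2 → K) (a₁ : K)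
    (hi : algebraMap (MvPolynomial (Fin 4) K) (OriginLocalization K 4) (X i) =
      ∑ k : Fin 2, algebraMap (MvPolynomial (Fin 4) K) (OriginLocalization K 4) (C (a k)) * c (Fin.castAdd 2 k) +
        algebraMap (MvPolynomial (Fin 4) K) (OriginLocalization K 4) (C a₁) * c (u1 2)) :
    algebraMap (MvPolynomial (Fin 4) K) (OriginLocalization K 4) (X i) ∈ yu1Ideal c := by
  rw [hi]
  refine Ideal.add_mem _ (Ideal.sum_mem _ fun k _ => Ideal.mul_mem_left _ _ ?_) (Ideal.mul_mem_left _ _ ?_)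
  · exact Ideal.subset_span (Set.mem_insert_of_mem _ ⟨k, rfl⟩)
  · exact Ideal.subset_span (Set.mem_insert _ _)

end PhiLine

end Summit.ResolutionOfSingularities.ResolutionOfSingularities.Theorems.PIDim4

end
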